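import Literature.AlgebraicGeometry.Resolution.HypersurfaceRestriction
import Literature.AlgebraicGeometry.Resolution.BlowupSequencesExtensions
import HarnessLib

/-!
# Restriction to a hypersurface through the centre commutes with the controlled transform (BGMW 2011, Lemma 3.9.4 (1)–(2); [Wlod] Lemma 3.10.3)

Topic: `Literature/AlgebraicGeometry/Resolution`. Layer of the decomposition of the named facts
`BierstoneGrigorievMilmanWlodarczyk2011_marked` / `_canonical` (Bierstone–Grigoriev–Milman–
Włodarczyk, arXiv:1206.3090, Thm. 8.0.5). The persistence clauses of Lemma 3.9.4 — for a
multiple blow-up `(X_i)` of `(X, 𝓘, E, μ)` with centres `C_i ⊆ S_i`, the strict transforms of a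
smooth hypersurface `S`, "(1) the restrictions `σ_{i|S_i} : S_i → S_{i-1}` define a multiple
blow-up `(S_i)` of `𝒞(𝓘, μ)|_S`; (2) `supp(𝓘_i, μ) ∩ S_i = supp[𝒞(𝓘, μ)|_S]_i`" — rest
("For details see [Wlod]") on the identity of Włodarczyk, *Simple Hironaka resolution in
characteristic zero*, Lemma 3.10.3:

  "Let `σ : X' → X` be a blow-up with center `C ⊂ supp(𝓘, μ) ∩ S`. Denote by `S' ⊂ X'` the
  strict transform of `S ⊂ X`. Then `σᶜ((𝓘, μ)|_S) = (σᶜ(𝓘, μ))|_{S'}`."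

([Wlod] proves it in formal coordinates: `f = Σ c_{α f}(y) x^α`, `f|_S = c_{0 f}|_S`.) Here it is
PROVED coordinate-free, for the regular hypersurface `S = V(H)` of `HypersurfaceRestriction.lean`
(`X` locally Noetherian and regular, `V(C) ⊆ V(H)` regular, `H` generated at each point of `V(H)`
by an element of order one, `S' = V(H')` with `H' = σᶜ(H, 1)`, `πS : S' → S` the induced
morphism, a blow-up of `S` along `C|_S` by the restriction property §4 Remark (3)): both sides
`K` satisfy `𝓘(D|_{S'})^a · K = (𝓘|_S)·𝒪_{S'}` and the exceptional divisor `D|_{S'}` of `πS` is an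
effective Cartier divisor, which can be cancelled:

* `IsEffectiveCartier.eq_of_mul_eq_mul`, `IsEffectiveCartier.le_of_mul_le_mul` — **effective
  Cartier divisors are cancellable** on ideal sheaves;
* **`IsBlowup.comap_subschemeι_controlledTransform`** — `(σᶜ(J, a))|_{S'} = (πS)ᶜ(J|_S, a)`
  (controlled transform along `πS` with centre `C|_S`) for every ideal sheaf `J` with
  `σ^*J ⊆ 𝓘(D)^a` (e.g. `V(C) ⊆ supp(J, a)` an admissible centre, BGMW Lemma 3.2.1);
* `IsBlowup.comap_subschemeι_transform_ideal` — for a marked ideal `(X, 𝓘, E, μ)` with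
  admissible centre `C` (`V(C) ⊆ supp(𝓘, μ)`, snc with `E`): the ideal of `(𝓘, μ)'|_{S'}` is
  the ideal of `((𝓘, μ)|_S)'`, restriction being `MarkedIdeal.comap` along the closed
  immersions (`BlowupSequencesExtensions.lean`) — the ideal part of [Wlod] Lemma 3.10.3 /
  of BGMW Lemma 3.9.4 (1)–(2), one blow-up.

The boundary parts (`E'|_{S'}` versus `(E|_S)'`) are not compared here.

## Sources

* E. Bierstone, D. Grigoriev, P. Milman, J. Włodarczyk, arXiv:1206.3090 (arXiv numbering):
  Lemma 3.9.4 (1)–(2) (p. 10), §4 Remark (3) (p. 11). [BierstoneGrigorievMilmanWlodarczyk2011]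
* J. Włodarczyk, *Simple Hironaka resolution in characteristic zero*, J. AMS 18 (2005),
  Lemma 3.10.3 (arXiv:math/0401401 numbering, p. 13). [Wlodarczyk2005]
-/

noncomputable section

open CategoryTheory CategoryTheory.Limits AlgebraicGeometry TopologicalSpace IsLocalRing

namespace Literature.AlgebraicGeometry.Resolution

universe u

/-! ## Effective Cartier divisors are cancellable -/

section Cartier

variable {X : Scheme.{u}}

/-- **An effective Cartier divisor can be cancelled from an inclusion**: `P · K ⊆ P · K'` implies
`K ⊆ K'` (locally `P = (g)` with `g` a nonzerodivisor: `g k = g k'` forces `k = k'`). [folklore] -/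
theorem IsEffectiveCartier.le_of_mul_le_mul {P K K' : X.IdealSheafData} (hP : IsEffectiveCartier P)
    (h : P * K ≤ P * K') : K ≤ K' := by
  choose U hxU g hg hPU using hP
  have hcov : ⨆ x, (U x : X.Opens) = ⊤ :=
    top_le_iff.mp fun x _ => Opens.mem_iSup.mpr ⟨x, hxU x⟩
  refine Scheme.IdealSheafData.le_of_iSup_eq_top U hcov fun x => ?_
  intro k hk
  have hmem : g x * k ∈ (P * K').ideal (U x) := by
    refine h (U x) ?_
    rw [Scheme.IdealSheafData.ideal_mul, Pi.mul_apply, hPU]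
    exact Ideal.mul_mem_mul (Ideal.mem_span_singleton_self _) hk
  rw [Scheme.IdealSheafData.ideal_mul, Pi.mul_apply, hPU, Ideal.mem_span_singleton_mul] at hmem
  obtain ⟨k', hk', hkk'⟩ := hmem
  have h0 : (k' - k) * g x = 0 := by rw [sub_mul, mul_comm k', hkk', mul_comm, sub_self]
  have : k' - k = 0 := (mem_nonZeroDivisors_iff_right.mp (hg x)) _ h0
  rwa [← sub_eq_zero.mp this]

/-- **An effective Cartier divisor can be cancelled**: `P · K = P · K'` implies `K = K'`.
[folklore] -/
theorem IsEffectiveCartier.eq_of_mul_eq_mul {P K K' : X.IdealSheafData} (hP : IsEffectiveCartier P)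
    (h : P * K = P * K') : K = K' :=
  le_antisymm (hP.le_of_mul_le_mul h.le) (hP.le_of_mul_le_mul h.ge)

end Cartier

/-! ## Restriction to `S' = V(H')` commutes with the controlled transform -/

section Restriction

variable {X X' : Scheme.{u}} [IsLocallyNoetherian X] {π : X' ⟶ X} {C H : X.IdealSheafData}

/-- **[Wlod] Lemma 3.10.3 / BGMW Lemma 3.9.4 (1)–(2), one blow-up, for ideal sheaves:
restriction to the strict transform of the hypersurface commutes with the controlled
transform.** Let `X` be locally Noetherian and regular, `π : X' → X` a blow-up along `C` with
`V(C)` regular, `H ⊆ C` generated at each point of `V(H)` by an element of order one (a regular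
hypersurface `S = V(H) ⊇ V(C)`), `S' = V(H')`, `H' = σᶜ(H, 1)`, and `πS : S' → S` the induced
morphism (a blow-up along `C|_S`, `IsBlowup.isBlowup_subscheme_controlledTransform`). Then for
every ideal sheaf `J` with `π^*J ⊆ 𝓘(D)^a` — e.g. `V(C) ⊆ supp(J, a)` an admissible centre —
`(σᶜ(J, a))|_{S'} = (πS)ᶜ(J|_S, a)`: both satisfy `𝓘(D|_{S'})^a · (–) = (J|_S) 𝒪_{S'}`, and the
effective Cartier divisor `D|_{S'}` cancels. [cite: Wlodarczyk2005, Lemma 3.10.3] -/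
theorem IsBlowup.comap_subschemeι_controlledTransform (hX : Scheme.IsRegular X)
    (hπ : IsBlowup π C) (hC : Scheme.IsRegular C.subscheme) (hHC : H ≤ C)
    (hH : ∀ x ∈ H.support, ∃ v : X.presheaf.stalk x,
      stalkIdeal H x = Ideal.span {v} ∧ v ∉ (maximalIdeal (X.presheaf.stalk x)) ^ 2)
    (πS : (controlledTransform π C H 1).subscheme ⟶ H.subscheme)
    (hπS : πS ≫ H.subschemeι = (controlledTransform π C H 1).subschemeι ≫ π)
    {J : X.IdealSheafData} {a : ℕ} (hJ : J.comap π ≤ C.comap π ^ a) :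
    (controlledTransform π C J a).comap (controlledTransform π C H 1).subschemeι =
      controlledTransform πS (C.comap H.subschemeι) (J.comap H.subschemeι) a := by
  haveI : IsProper π := hπ.isProper
  haveI : IsLocallyNoetherian X' := LocallyOfFiniteType.isLocallyNoetherian π
  haveI : IsLocallyNoetherian (controlledTransform π C H 1).subscheme :=
    LocallyOfFiniteType.isLocallyNoetherian (controlledTransform π C H 1).subschemeι
  -- the exceptional divisor restricted to `S'`, an effective Cartier divisor
  have hD' : IsEffectiveCartier ((C.comap π).comap (controlledTransform π C H 1).subschemeι) :=
    hπ.isEffectiveCartier_comap_subschemeι_controlledTransform hX hC hHC hH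
  have hDS : (C.comap H.subschemeι).comap πS =
      (C.comap π).comap (controlledTransform π C H 1).subschemeι := by
    rw [← Scheme.IdealSheafData.comap_comp, hπS, Scheme.IdealSheafData.comap_comp]
  have hJS : (J.comap H.subschemeι).comap πS =
      (J.comap π).comap (controlledTransform π C H 1).subschemeι := by
    rw [← Scheme.IdealSheafData.comap_comp, hπS, Scheme.IdealSheafData.comap_comp]
  -- `𝓘(D|S')^a · LHS = (J|_S) 𝒪_{S'}`
  have h1 : ((C.comap π).comap (controlledTransform π C H 1).subschemeι) ^ a *
      (controlledTransform π C J a).comap (controlledTransform π C H 1).subschemeι =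
        (J.comap π).comap (controlledTransform π C H 1).subschemeι := by
    rw [← comap_pow, ← comap_mul, pow_mul_controlledTransform_eq π C hπ.isEffectiveCartier hJ]
  -- `𝓘(D|S')^a · RHS = (J|_S) 𝒪_{S'}`
  have hle : (J.comap H.subschemeι).comap πS ≤ (C.comap H.subschemeι).comap πS ^ a := by
    rw [hJS, hDS, ← comap_pow]
    exact Scheme.IdealSheafData.comap_mono (f := (controlledTransform π C H 1).subschemeι) hJ
  have h2 := pow_mul_controlledTransform_eq πS (C.comap H.subschemeι) (hDS ▸ hD') hle
  rw [hJS, hDS, ← h1] at h2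
  exact ((hD'.pow a).eq_of_mul_eq_mul h2).symm

/-- **The ideal of `(𝓘, μ)'|_{S'}` is the ideal of `((𝓘, μ)|_S)'`** ([Wlod] Lemma 3.10.3 for a
marked ideal with admissible centre; BGMW Lemma 3.9.4 (1)–(2), one blow-up): with `X`, `π`,
`C`, `H`, `πS` as in `IsBlowup.comap_subschemeι_controlledTransform` and a marked ideal
`M = (X, 𝓘, E, μ)` with `V(C) ⊆ supp(𝓘, μ)` and `C` snc with `E` (so `π^*𝓘 ⊆ 𝓘(D)^μ`, BGMW
Lemma 3.2.1), the restricted transform `(M')|_{S'} := ι'^*(M.transform π C)` and the transform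
of the restriction `(ι^*M)'` along `πS` with centre `C|_S` (`MarkedIdeal.comap`,
`MarkedIdeal.transform`) have the same ideal (and the same multiplicity `μ`).
[cite: BierstoneGrigorievMilmanWlodarczyk2011, Lemma 3.9.4 (1)–(2)] -/
theorem IsBlowup.comap_subschemeι_transform_ideal (hX : Scheme.IsRegular X)
    (hπ : IsBlowup π C) (hC : Scheme.IsRegular C.subscheme) (hHC : H ≤ C)
    (hH : ∀ x ∈ H.support, ∃ v : X.presheaf.stalk x,
      stalkIdeal H x = Ideal.span {v} ∧ v ∉ (maximalIdeal (X.presheaf.stalk x)) ^ 2)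
    (πS : (controlledTransform π C H 1).subscheme ⟶ H.subscheme)
    (hπS : πS ≫ H.subschemeι = (controlledTransform π C H 1).subschemeι ≫ π)
    (M : MarkedIdeal X) (hsupp : (C.support : Set X) ⊆ M.support) (hsnc : HasSNCWith M.boundary C) :
    ((M.transform π C).comap (controlledTransform π C H 1).subschemeι).ideal =
      ((M.comap H.subschemeι).transform πS (C.comap H.subschemeι)).ideal := by
  rw [MarkedIdeal.comap_ideal, MarkedIdeal.transform_ideal, MarkedIdeal.transform_ideal,
    MarkedIdeal.comap_ideal, MarkedIdeal.comap_mult]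
  exact hπ.comap_subschemeι_controlledTransform hX hC hHC hH πS hπS (M.comap_ideal_le_pow hsupp hsnc π)

end Restriction

end Literature.AlgebraicGeometry.Resolution

end
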